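import Summits.QuantumFields.YangMills.Theorems.CurvatureKernelBound.Negative.L1Package

/-!
# `CurvatureKernelBound` — negative lemmas, `ℓ¹` witness V: the sum-of-squares representation of `K(θa − b)`

Supports crux item `stmt-QuantumFields-11687` (`PencilRigidity.CurvatureKernelBound`). Standing disprover's negative
lemmas (refuter, cdisprove cycle 3), ORDER-INSUFFICIENCY WITH REGULARITY chain `L1Kernel → L1Flat → L1Extension →
L1Package → L1RPKernel → L1RP → L1Main`, culminating in `L1Witness.not_axialGrowthOfTwoPointPackage`: the two-point
shadow of `W₁ ∖ lattice` plus a representing kernel continuous off `0` do NOT imply the axial growth bound of Stub E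
(`AxialGrowth`) of line `sixteen-charts-analytic-kernel`. No conclusion below asserts a Theses statement positively.

`kk λ p s = 1_{s≤p} e^{-λ(p−s)}` with `∫ kk λ p · kk λ q = e^{-λ|p−q|}/(2λ)` (`integral_kk_mul_kk`); the spatial
factor `sp λ s a = ∏_{k=1}^{3} kk λ a_k s_{k−1}` with `∫_{ℝ³} sp(a) sp(b) = ∏_k e^{-λ|a_k−b_k|}/(2λ)` (Fubini over
`Fin 3`); `ψ_ω(a) = e^{-λ a⁰} sp λ s a`, `w(λ) = 1_{λ>1} λ⁹(2λ)³`; `ℓ¹(θa − b) = a⁰ + b⁰ + Σ_k |a_k − b_k|` for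
`a⁰, b⁰ > 0`; and **`integral_w_psi_psi : ∫_Ω w ψ_ω(a) ψ_ω(b) dω = K(θa − b)`** for `a⁰, b⁰ > 0` (integrability on
`Ω = ℝ × ℝ³` through `integrable_prod_iff`, inner `s`-integral `λ⁹ e^{-λ ℓ¹(θa−b)}`, outer `λ`-integral `= k₁`),
with `integrable_w_psi_psi`. [folklore]
-/

open scoped BigOperators Topology SchwartzMap
open MeasureTheory Filter Set Real
open Literature.MathematicalPhysics.QuantumLattice Literature.MathematicalPhysics.AQFT

noncomputable section

namespace Summit.QuantumFields.YangMills.Theorems.CurvatureKernelBound.Negative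

namespace L1Witness

/-! ### Reflection positivity of `T`, I: the sum-of-squares representation of `K(θa − b)` -/

section RPKernel

/-- The one-dimensional "square root" `kk λ p s = 1_{s ≤ p} e^{-λ(p−s)}` of the exponential kernel:
`e^{-λ|p−q|} = 2λ ∫ kk λ p s · kk λ q s ds`. -/
def kk (lam p s : ℝ) : ℝ := (Iic p).indicator (fun s => exp (-(lam * (p - s)))) s

/-- Auxiliary fact `kk_nonneg` of the `ℓ¹`-witness construction (see the module docstring). [folklore] -/
theorem kk_nonneg (lam p s : ℝ) : 0 ≤ kk lam p s := by
  unfold kk; exact Set.indicator_nonneg (fun _ _ => (exp_pos _).le) _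

/-- Auxiliary fact `kk_mul_kk` of the `ℓ¹`-witness construction (see the module docstring). [folklore] -/
theorem kk_mul_kk (lam p q s : ℝ) :
    kk lam p s * kk lam q s =
      (Iic (min p q)).indicator (fun s => exp (-(lam * (p + q)) + 2 * lam * s)) s := by
  unfold kk
  by_cases hp : s ≤ p <;> by_cases hq : s ≤ q
  · rw [indicator_of_mem (mem_Iic.2 hp), indicator_of_mem (mem_Iic.2 hq),
      indicator_of_mem (mem_Iic.2 (le_min hp hq)), ← Real.exp_add]
    congr 1; ring
  · rw [indicator_of_notMem (fun h => hq (mem_Iic.1 h)), mul_zero,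
      indicator_of_notMem (fun h => hq ((mem_Iic.1 h).trans (min_le_right _ _)))]
  · rw [indicator_of_notMem (fun h => hp (mem_Iic.1 h)), zero_mul,
      indicator_of_notMem (fun h => hp ((mem_Iic.1 h).trans (min_le_left _ _)))]
  · rw [indicator_of_notMem (fun h => hp (mem_Iic.1 h)), zero_mul,
      indicator_of_notMem (fun h => hp ((mem_Iic.1 h).trans (min_le_left _ _)))]

/-- Auxiliary fact `measurable_kk_uncurry` of the `ℓ¹`-witness construction (see the module docstring). [folklore] -/
theorem measurable_kk_uncurry (lam : ℝ) : Measurable fun z : ℝ × ℝ => kk lam z.1 z.2 := by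
  unfold kk
  have hset : MeasurableSet {z : ℝ × ℝ | z.2 ≤ z.1} :=
    measurableSet_le measurable_snd measurable_fst
  have : (fun z : ℝ × ℝ => (Iic z.1).indicator (fun s => exp (-(lam * (z.1 - s)))) z.2) =
      {z : ℝ × ℝ | z.2 ≤ z.1}.indicator (fun z => exp (-(lam * (z.1 - z.2)))) := by
    funext z
    by_cases h : z.2 ≤ z.1
    · rw [indicator_of_mem (mem_Iic.2 h), indicator_of_mem (show z ∈ {z : ℝ × ℝ | z.2 ≤ z.1} from h)]
    · rw [indicator_of_notMem (fun h' => h (mem_Iic.1 h')),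
        indicator_of_notMem (show z ∉ {z : ℝ × ℝ | z.2 ≤ z.1} from h)]
  rw [this]
  exact Measurable.indicator (by fun_prop) hset

/-- Auxiliary fact `measurable_kk` of the `ℓ¹`-witness construction (see the module docstring). [folklore] -/
theorem measurable_kk (lam p : ℝ) : Measurable (kk lam p) :=
  (measurable_kk_uncurry lam).comp (measurable_const.prodMk measurable_id)

/-- `∫ kk λ p · kk λ q = e^{-λ|p−q|} / (2λ)`. -/
theorem integral_kk_mul_kk {lam : ℝ} (hlam : 0 < lam) (p q : ℝ) :
    ∫ s, kk lam p s * kk lam q s = exp (-(lam * |p - q|)) / (2 * lam) := by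
  simp_rw [kk_mul_kk]
  rw [integral_indicator measurableSet_Iic]
  have h2 : (0 : ℝ) < 2 * lam := by linarith
  have : ∫ s in Iic (min p q), exp (-(lam * (p + q)) + 2 * lam * s) =
      exp (-(lam * (p + q))) * ∫ s in Iic (min p q), exp (2 * lam * s) := by
    rw [← integral_const_mul]
    refine setIntegral_congr_fun measurableSet_Iic fun s _ => ?_
    rw [Real.exp_add]
  rw [this, integral_exp_mul_Iic h2, ← mul_div_assoc, ← Real.exp_add]
  congr 1
  rcases le_total p q with h | h
  · rw [min_eq_left h, abs_of_nonpos (by linarith)]; ring_nf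
  · rw [min_eq_right h, abs_of_nonneg (by linarith)]; ring_nf

/-- Auxiliary fact `integrable_kk_mul_kk` of the `ℓ¹`-witness construction (see the module docstring). [folklore] -/
theorem integrable_kk_mul_kk {lam : ℝ} (hlam : 0 < lam) (p q : ℝ) :
    Integrable fun s => kk lam p s * kk lam q s := by
  simp_rw [kk_mul_kk]
  rw [integrable_indicator_iff measurableSet_Iic]
  have h2 : (0 : ℝ) < 2 * lam := by linarith
  have h3 : IntegrableOn (fun s => exp (-(lam * (p + q))) * exp (2 * lam * s)) (Iic (min p q)) :=
    (integrableOn_exp_mul_Iic h2 (min p q)).const_mul (exp (-(lam * (p + q))))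
  exact IntegrableOn.congr_fun h3 (fun s _ => by rw [Real.exp_add]) measurableSet_Iic

/-- The spatial factor `sp λ s a = ∏_{k=1}^{3} kk λ (a_k) (s_{k-1})`. -/
def sp (lam : ℝ) (s : Fin 3 → ℝ) (a : E4) : ℝ := ∏ k : Fin 3, kk lam (a k.succ) (s k)

/-- Auxiliary fact `sp_nonneg` of the `ℓ¹`-witness construction (see the module docstring). [folklore] -/
theorem sp_nonneg (lam : ℝ) (s : Fin 3 → ℝ) (a : E4) : 0 ≤ sp lam s a :=
  Finset.prod_nonneg fun _ _ => kk_nonneg _ _ _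

/-- Auxiliary fact `sp_mul_sp` of the `ℓ¹`-witness construction (see the module docstring). [folklore] -/
theorem sp_mul_sp (lam : ℝ) (s : Fin 3 → ℝ) (a b : E4) :
    sp lam s a * sp lam s b = ∏ k : Fin 3, (kk lam (a k.succ) (s k) * kk lam (b k.succ) (s k)) := by
  rw [sp, sp, ← Finset.prod_mul_distrib]

/-- Auxiliary fact `integral_sp_mul_sp` of the `ℓ¹`-witness construction (see the module docstring). [folklore] -/
theorem integral_sp_mul_sp {lam : ℝ} (hlam : 0 < lam) (a b : E4) :
    ∫ s : Fin 3 → ℝ, sp lam s a * sp lam s b =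
      ∏ k : Fin 3, (exp (-(lam * |a k.succ - b k.succ|)) / (2 * lam)) := by
  simp_rw [sp_mul_sp]
  rw [integral_fintype_prod_volume_eq_prod
    (fun (k : Fin 3) (t : ℝ) => kk lam (a k.succ) t * kk lam (b k.succ) t)]
  exact Finset.prod_congr rfl fun k _ => integral_kk_mul_kk hlam _ _

/-- Auxiliary fact `integrable_sp_mul_sp` of the `ℓ¹`-witness construction (see the module docstring). [folklore] -/
theorem integrable_sp_mul_sp {lam : ℝ} (hlam : 0 < lam) (a b : E4) :
    Integrable fun s : Fin 3 → ℝ => sp lam s a * sp lam s b := by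
  simp_rw [sp_mul_sp]
  exact Integrable.fintype_prod (f := fun (k : Fin 3) (t : ℝ) => kk lam (a k.succ) t * kk lam (b k.succ) t)
    (fun k => integrable_kk_mul_kk hlam _ _)

/-- Parameter space `Ω = ℝ × ℝ³` (`λ` and the three spatial square-root variables). -/
abbrev Ω : Type := ℝ × (Fin 3 → ℝ)

/-- The weight `w(λ) = 1_{λ>1} λ⁹ (2λ)³`. -/
def wt' (lam : ℝ) : ℝ := (Ioi (1 : ℝ)).indicator (fun lam => lam ^ 9 * (2 * lam) ^ 3) lam

/-- Auxiliary fact `wt'_nonneg` of the `ℓ¹`-witness construction (see the module docstring). [folklore] -/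
theorem wt'_nonneg (lam : ℝ) : 0 ≤ wt' lam := by
  unfold wt'
  refine Set.indicator_nonneg (fun t ht => ?_) _
  have : (0 : ℝ) < t := zero_lt_one.trans ht
  positivity

/-- Auxiliary fact `wt'_of_mem` of the `ℓ¹`-witness construction (see the module docstring). [folklore] -/
theorem wt'_of_mem {lam : ℝ} (h : 1 < lam) : wt' lam = lam ^ 9 * (2 * lam) ^ 3 := by
  unfold wt'; rw [indicator_of_mem (mem_Ioi.2 h)]

/-- Auxiliary fact `wt'_of_not_mem` of the `ℓ¹`-witness construction (see the module docstring). [folklore] -/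
theorem wt'_of_not_mem {lam : ℝ} (h : ¬ 1 < lam) : wt' lam = 0 := by
  unfold wt'; rw [indicator_of_notMem (fun h' => h (mem_Ioi.1 h'))]

/-- Auxiliary fact `measurable_wt'` of the `ℓ¹`-witness construction (see the module docstring). [folklore] -/
theorem measurable_wt' : Measurable wt' := by
  unfold wt'; exact Measurable.indicator (by fun_prop) measurableSet_Ioi

/-- `ψ_ω(a) = e^{-λ a⁰} sp λ s a`. -/
def psi (ω : Ω) (a : E4) : ℝ := exp (-(ω.1 * a 0)) * sp ω.1 ω.2 a

/-- Auxiliary fact `psi_nonneg` of the `ℓ¹`-witness construction (see the module docstring). [folklore] -/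
theorem psi_nonneg (ω : Ω) (a : E4) : 0 ≤ psi ω a := mul_nonneg (exp_pos _).le (sp_nonneg _ _ _)

/-- `ℓ¹(θa − b) = (a⁰ + b⁰) + Σ_{k≥1} |a_k − b_k|` for `a⁰, b⁰ > 0`. -/
theorem l1_theta_sub {a b : E4} (ha : 0 < a 0) (hb : 0 < b 0) :
    l1 (timeReflection 4 a - b) = (a 0 + b 0) + ∑ k : Fin 3, |a k.succ - b k.succ| := by
  have h0 : (timeReflection 4 a - b) 0 = -a 0 - b 0 := by simp [timeReflection_apply]
  have hk : ∀ k : Fin 3, (timeReflection 4 a - b) k.succ = a k.succ - b k.succ := fun k => by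
    simp [timeReflection_apply, Fin.succ_ne_zero]
  rw [l1, Fin.sum_univ_succ, h0, abs_of_nonpos (by linarith)]
  simp only [hk]
  ring

/-- For `λ > 1` and `a⁰, b⁰ > 0`: `∫_s w(λ) ψ(a) ψ(b) ds = λ⁹ e^{-λ ℓ¹(θa−b)}`. -/
theorem integral_s_wpsi {lam : ℝ} (hlam : 1 < lam) {a b : E4} (ha : 0 < a 0) (hb : 0 < b 0) :
    ∫ s : Fin 3 → ℝ, wt' lam * (psi (lam, s) a * psi (lam, s) b) =
      kint (l1 (timeReflection 4 a - b)) lam := by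
  have hlam0 : 0 < lam := zero_lt_one.trans hlam
  have hfun : ∀ s : Fin 3 → ℝ, wt' lam * (psi (lam, s) a * psi (lam, s) b) =
      (wt' lam * (exp (-(lam * a 0)) * exp (-(lam * b 0)))) * (sp lam s a * sp lam s b) := by
    intro s; simp only [psi]; ring
  simp_rw [hfun]
  rw [integral_const_mul, integral_sp_mul_sp hlam0, wt'_of_mem hlam, l1_theta_sub ha hb, kint]
  have hprod : ∏ k : Fin 3, (exp (-(lam * |a k.succ - b k.succ|)) / (2 * lam)) =
      exp (∑ k : Fin 3, -(lam * |a k.succ - b k.succ|)) / (2 * lam) ^ 3 := by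
    rw [Finset.prod_div_distrib, Finset.prod_const, Finset.card_univ, Fintype.card_fin, Real.exp_sum]
  rw [hprod]
  have h2 : (2 * lam) ^ 3 ≠ 0 := by positivity
  calc lam ^ 9 * (2 * lam) ^ 3 * (exp (-(lam * a 0)) * exp (-(lam * b 0))) *
        (exp (∑ k : Fin 3, -(lam * |a k.succ - b k.succ|)) / (2 * lam) ^ 3)
      = lam ^ 9 * (exp (-(lam * a 0)) * exp (-(lam * b 0)) *
          exp (∑ k : Fin 3, -(lam * |a k.succ - b k.succ|))) * ((2 * lam) ^ 3 / (2 * lam) ^ 3) := by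
        ring
    _ = lam ^ 9 * exp (-((a 0 + b 0 + ∑ k : Fin 3, |a k.succ - b k.succ|) * lam)) := by
        rw [div_self h2, mul_one, ← Real.exp_add, ← Real.exp_add]
        congr 1
        rw [Finset.sum_neg_distrib, ← Finset.mul_sum]
        ring

/-- Auxiliary fact `integrable_s_wpsi` of the `ℓ¹`-witness construction (see the module docstring). [folklore] -/
theorem integrable_s_wpsi {lam : ℝ} (a b : E4) :
    Integrable fun s : Fin 3 → ℝ => wt' lam * (psi (lam, s) a * psi (lam, s) b) := by
  by_cases hlam : 1 < lam
  · have hlam0 : 0 < lam := zero_lt_one.trans hlam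
    have hfun : ∀ s : Fin 3 → ℝ, wt' lam * (psi (lam, s) a * psi (lam, s) b) =
        (wt' lam * (exp (-(lam * a 0)) * exp (-(lam * b 0)))) * (sp lam s a * sp lam s b) := by
      intro s; simp only [psi]; ring
    simp_rw [hfun]
    exact (integrable_sp_mul_sp hlam0 a b).const_mul _
  · simp_rw [wt'_of_not_mem hlam, zero_mul]
    exact integrable_zero _ _ _

/-- Auxiliary fact `measurable_psi_uncurry` of the `ℓ¹`-witness construction (see the module docstring). [folklore] -/
theorem measurable_psi_uncurry : Measurable fun z : Ω × E4 => psi z.1 z.2 := by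
  unfold psi sp
  refine Measurable.mul (by fun_prop) ?_
  refine Finset.measurable_prod _ fun k _ => ?_
  have h1 : Measurable fun z : Ω × E4 => (z.2 k.succ, z.1.2 k) := by fun_prop
  -- kk lam p s with lam = z.1.1, p = z.2 k.succ, s = z.1.2 k
  have h3 : Measurable fun q : ℝ × (ℝ × ℝ) => kk q.1 q.2.1 q.2.2 := by
    unfold kk
    have hset : MeasurableSet {q : ℝ × (ℝ × ℝ) | q.2.2 ≤ q.2.1} :=
      measurableSet_le (measurable_snd.comp measurable_snd) (measurable_fst.comp measurable_snd)
    have : (fun q : ℝ × (ℝ × ℝ) => (Iic q.2.1).indicator (fun s => exp (-(q.1 * (q.2.1 - s)))) q.2.2) =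
        {q : ℝ × (ℝ × ℝ) | q.2.2 ≤ q.2.1}.indicator (fun q => exp (-(q.1 * (q.2.1 - q.2.2)))) := by
      funext q
      by_cases h : q.2.2 ≤ q.2.1
      · rw [indicator_of_mem (mem_Iic.2 h),
          indicator_of_mem (show q ∈ {q : ℝ × (ℝ × ℝ) | q.2.2 ≤ q.2.1} from h)]
      · rw [indicator_of_notMem (fun h' => h (mem_Iic.1 h')),
          indicator_of_notMem (show q ∉ {q : ℝ × (ℝ × ℝ) | q.2.2 ≤ q.2.1} from h)]
    rw [this]
    exact Measurable.indicator (by fun_prop) hset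
  exact h3.comp (by fun_prop : Measurable fun z : Ω × E4 => (z.1.1, (z.2 k.succ, z.1.2 k)))

/-- Auxiliary fact `measurable_psi_left` of the `ℓ¹`-witness construction (see the module docstring). [folklore] -/
theorem measurable_psi_left (a : E4) : Measurable fun ω : Ω => psi ω a :=
  measurable_psi_uncurry.comp (measurable_id.prodMk measurable_const)

/-- **Sum of squares.** For `a⁰, b⁰ > 0`: `K(θa − b) = ∫_Ω w ψ_ω(a) ψ_ω(b) dω`. -/
theorem integral_w_psi_psi {a b : E4} (ha : 0 < a 0) (hb : 0 < b 0) :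
    ∫ ω : Ω, wt' ω.1 * (psi ω a * psi ω b) = Kw (timeReflection 4 a - b) := by
  set L := l1 (timeReflection 4 a - b) with hL
  have hLpos : 0 < L := by
    rw [hL, l1_theta_sub ha hb]
    have : 0 ≤ ∑ k : Fin 3, |a k.succ - b k.succ| := Finset.sum_nonneg fun _ _ => abs_nonneg _
    linarith
  have hint : Integrable (fun ω : Ω => wt' ω.1 * (psi ω a * psi ω b)) (volume.prod volume) := by
    rw [integrable_prod_iff]
    · refine ⟨ae_of_all _ fun lam => integrable_s_wpsi a b, ?_⟩
      have hnorm : ∀ lam : ℝ, ∫ s : Fin 3 → ℝ, ‖wt' lam * (psi (lam, s) a * psi (lam, s) b)‖ =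
          (Ioi (1 : ℝ)).indicator (kint L) lam := by
        intro lam
        have : ∀ s : Fin 3 → ℝ, ‖wt' lam * (psi (lam, s) a * psi (lam, s) b)‖ =
            wt' lam * (psi (lam, s) a * psi (lam, s) b) := fun s =>
          Real.norm_of_nonneg (mul_nonneg (wt'_nonneg _) (mul_nonneg (psi_nonneg _ _) (psi_nonneg _ _)))
        simp_rw [this]
        by_cases hlam : 1 < lam
        · rw [integral_s_wpsi hlam ha hb, indicator_of_mem (mem_Ioi.2 hlam)]
        · simp_rw [wt'_of_not_mem hlam, zero_mul, integral_zero]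
          rw [indicator_of_notMem (fun h => hlam (mem_Ioi.1 h))]
      simp_rw [hnorm]
      exact (integrable_indicator_iff measurableSet_Ioi).2 (integrableOn_kint hLpos)
    · exact ((measurable_wt'.comp measurable_fst).mul
        ((measurable_psi_left a).mul (measurable_psi_left b))).aestronglyMeasurable
  rw [show (volume : Measure Ω) = volume.prod volume from rfl, integral_prod _ hint]
  have hinner : ∀ lam : ℝ, ∫ s : Fin 3 → ℝ, wt' lam * (psi (lam, s) a * psi (lam, s) b) =
      (Ioi (1 : ℝ)).indicator (kint L) lam := by
    intro lam
    by_cases hlam : 1 < lam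
    · rw [integral_s_wpsi hlam ha hb, indicator_of_mem (mem_Ioi.2 hlam)]
    · simp_rw [wt'_of_not_mem hlam, zero_mul, integral_zero]
      rw [indicator_of_notMem (fun h => hlam (mem_Ioi.1 h))]
  simp_rw [show ∀ lam : ℝ, (∫ s : Fin 3 → ℝ, wt' (lam, s).1 * (psi (lam, s) a * psi (lam, s) b)) =
    (Ioi (1 : ℝ)).indicator (kint L) lam from hinner]
  rw [integral_indicator measurableSet_Ioi]
  rfl

/-- Integrability of `ω ↦ w ψ_ω(a) ψ_ω(b)` for `a⁰, b⁰ > 0`. -/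
theorem integrable_w_psi_psi {a b : E4} (ha : 0 < a 0) (hb : 0 < b 0) :
    Integrable (fun ω : Ω => wt' ω.1 * (psi ω a * psi ω b)) := by
  set L := l1 (timeReflection 4 a - b) with hL
  have hLpos : 0 < L := by
    rw [hL, l1_theta_sub ha hb]
    have : 0 ≤ ∑ k : Fin 3, |a k.succ - b k.succ| := Finset.sum_nonneg fun _ _ => abs_nonneg _
    linarith
  rw [show (volume : Measure Ω) = volume.prod volume from rfl, integrable_prod_iff]
  · refine ⟨ae_of_all _ fun lam => integrable_s_wpsi a b, ?_⟩
    have hnorm : ∀ lam : ℝ, ∫ s : Fin 3 → ℝ, ‖wt' lam * (psi (lam, s) a * psi (lam, s) b)‖ =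
        (Ioi (1 : ℝ)).indicator (kint L) lam := by
      intro lam
      have : ∀ s : Fin 3 → ℝ, ‖wt' lam * (psi (lam, s) a * psi (lam, s) b)‖ =
          wt' lam * (psi (lam, s) a * psi (lam, s) b) := fun s =>
        Real.norm_of_nonneg (mul_nonneg (wt'_nonneg _) (mul_nonneg (psi_nonneg _ _) (psi_nonneg _ _)))
      simp_rw [this]
      by_cases hlam : 1 < lam
      · rw [integral_s_wpsi hlam ha hb, indicator_of_mem (mem_Ioi.2 hlam)]
      · simp_rw [wt'_of_not_mem hlam, zero_mul, integral_zero]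
        rw [indicator_of_notMem (fun h => hlam (mem_Ioi.1 h))]
    simp_rw [hnorm]
    exact (integrable_indicator_iff measurableSet_Ioi).2 (integrableOn_kint hLpos)
  · exact ((measurable_wt'.comp measurable_fst).mul
      ((measurable_psi_left a).mul (measurable_psi_left b))).aestronglyMeasurable

end RPKernel

end L1Witness

end Summit.QuantumFields.YangMills.Theorems.CurvatureKernelBound.Negative
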